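import Literature.AnabelianGeometry.EtaleTheta.Discharge.Sec3Cor38SubPreStepsRightAbsorbed
import HarnessLib

/-!
# [EtTh] Cor. 3.8, proof row C38-L02a `PreservesPreSteps` (F-2809): the right-absorbed class IN COORDINATES —
# absorption of a unit-free translation is divisor absorption (addendum to `Sec3Cor38SubPreStepsRightAbsorbed`)

S. Mochizuki, *The étale theta function …*, Publ. RIMS **45** (2009), Cor. 3.8 proof, PDF p. 81 l.2–3
[cite: MochizukiEtTh2009, Cor 3.8 p.81]; S. Mochizuki, *The geometry of Frobenioids I* (2008), Thm. 5.2 (i) p.100 (the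
model category: `Div(ψ ∘ φ) = Base(φ)^* Div(ψ) + deg_Fr(ψ)·Div(φ)`, `u_{ψ∘φ} = Base(φ)^* u_ψ + deg_Fr(ψ)·u_φ`)
[cite: MochizukiFrdI2008, Thm. 5.2 (i) p.100].

abc-iut cell, block F, seat abc-iut-f-032 (gen 7; F-2809 decision lease).  PROOF-ONLY addendum (0 definitions, nothing of
abc-iut-f-130's `Sec3Cor38SubPreStepsRightAbsorbed.lean` p467598 restated — its theorems are consumed BY NAME).  That file
proves: an arrow `y` with `x ≫ y = x` is a pre-step and is carried to a pre-step by EVERY `h : Cor38Hyp C₁ C₂`.  HERE the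
class is located in the coordinates of [FrdI] Thm. 5.2 (i), so that the closure-side census knows exactly which typed data
inhabit it:
* `ModelFrobenioid.comp_eq_self_iff_div` — for a unit-free base-identity linear arrow `y = (1, id, z, 1)` of ANY model
  Frobenioid, `x ≫ y = x` holds IFF `Base(x)^*(z) · Div(x) = Div(x)` in `Φ(Base x)`: right absorption is exactly
  DIVISOR ABSORPTION after pull-back — inhabited precisely over NON-CANCELLATIVE divisor monoids (`ω + z = ω`; such
  data are admissible as typed: desk census abc-iut-f-135 gen 4 §A4, abc-iut-L1-t13 gen 7 §A), empty over cancellative ones;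
* `Cor38Hyp.functor_map_isPreStep_of_div_absorbed` / `inverse_map_isPreStep_of_div_absorbed` — hence every such
  translation whose divisor is absorbed by the divisor of SOME incoming arrow is a `Ψ`-pre-step and a `Ψ⁻¹`-pre-step for
  every record: the non-cancellative "dying-step" families cannot separate F-2809.
READING (cell rule R5): FACT-LIST label of F-2809 NOT moved (conditional / instance PROVED / bare closure undecided).
HONEST FRAMING: bookkeeping about OUR typed Def. 3.6 interface; nothing here bears on [EtTh] Cor. 3.8 as printed or on the
disputed [IUTchIII] Cor. 3.12; no side taken; typed ≠ proved.
-/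

namespace Literature.AlgebraicGeometry.Frobenioids

open CategoryTheory Opposite

universe w v u

namespace ModelFrobenioid

variable {D : Type u} [Category.{v} D] {Φ B : Dᵒᵖ ⥤ CommMonCat.{w}} {DivB : B ⟶ monoidGp Φ}

/-- **Right absorption is divisor absorption.**  For a unit-free base-identity linear arrow `y = (1, id, z, 1)` of a
model Frobenioid ([FrdI] Thm. 5.2 (i)) and any `x` into its source, `x ≫ y = x` iff `Base(x)^*(z) · Div(x) = Div(x)`:
the degree, base and unit components of `x ≫ y` and `x` agree automatically, and the divisor component of the composite is
`Base(x)^* Div(y) + deg_Fr(y)·Div(x)`. [cite: MochizukiFrdI2008, Thm. 5.2 (i) p.100] -/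
theorem comp_eq_self_iff_div {W X : ModelFrobenioid Φ B DivB} (x : W ⟶ X) (y : X ⟶ X) (hd : degFr y = 1)
    (hb : baseMap y = 𝟙 X.base) (hu : unit y = 1) :
    x ≫ y = x ↔ (Φ.map (baseMap x).op).hom (div y) * div x = div x := by
  constructor
  · intro e
    have h := congrArg Hom.div e
    change (Φ.map (baseMap x).op).hom (div y) * div x ^ (degFr y : ℕ) = div x at h
    rwa [hd, PNat.one_coe, pow_one] at h
  · intro h
    apply hom_ext
    · rw [degFr_comp, hd, one_mul]
    · rw [baseMap_comp, hb, Category.comp_id]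
    · rw [div_comp, hd, PNat.one_coe, pow_one, h]
    · rw [unit_comp, hu, map_one, one_mul, hd, PNat.one_coe, pow_one]

/-- In particular over a CANCELLATIVE divisor monoid `Φ(Base x)` a unit-free base-identity linear arrow with non-trivial
pulled-back divisor absorbs nothing: `x ≫ y = x` forces `Base(x)^*(Div y) = 0`. [cite: MochizukiFrdI2008, Thm. 5.2 (i) p.100] -/
theorem map_div_eq_one_of_comp_eq_self {W X : ModelFrobenioid Φ B DivB} [IsRightCancelMul (Φ.obj (op W.base))]
    (x : W ⟶ X) (y : X ⟶ X) (hd : degFr y = 1) (hb : baseMap y = 𝟙 X.base)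
    (hu : unit y = 1) (e : x ≫ y = x) : (Φ.map (baseMap x).op).hom (div y) = 1 := by
  have h := (comp_eq_self_iff_div x y hd hb hu).mp e
  have h' : (Φ.map (baseMap x).op).hom (div y) * div x = 1 * div x := by rw [h, one_mul]
  exact mul_right_cancel h'

end ModelFrobenioid

end Literature.AlgebraicGeometry.Frobenioids

namespace Literature.AnabelianGeometry.EtaleTheta

open CategoryTheory Opposite Literature.AlgebraicGeometry.Frobenioids

universe u₀ v₀ u v w

variable {D₀ : Type u₀} [Category.{v₀} D₀] {V : FrdIMonoidStub.{w}}
  {T : RealifiedDivisorMonoids (D₀ := D₀) V} {D : Type u} [Category.{v} D] {VD : FrdICatStub.{u, v, w} D}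
  {D₀' : Type u₀} [Category.{v₀} D₀'] {T' : RealifiedDivisorMonoids (D₀ := D₀') V}
  {D' : Type u} [Category.{v} D'] {VD' : FrdICatStub.{u, v, w} D'}
  {C₁ : TemperedFrobenioid T D VD} {C₂ : TemperedFrobenioid T' D' VD'}

namespace Cor38Hyp

variable (h : Cor38Hyp C₁ C₂)

/-- **F-2809 on divisor-absorbed translations, direction `Ψ`.**  A unit-free base-identity linear arrow `y = (1, id, z, 1)`
of `C₁` whose divisor is absorbed, after pull-back, by the divisor of some incoming `x` (`Base(x)^*(z)·Div(x) = Div(x)`) is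
carried to a pre-step of `C₂` by EVERY record `h` (abc-iut-f-130's right-absorbed theorem, fed with the coordinate form).
[cite: MochizukiEtTh2009, Cor 3.8 p.81] -/
theorem functor_map_isPreStep_of_div_absorbed {W X : C₁.category} (x : W ⟶ X) (y : X ⟶ X)
    (hd : ModelFrobenioid.degFr y = 1) (hb : ModelFrobenioid.baseMap y = 𝟙 X.base) (hu : ModelFrobenioid.unit y = 1)
    (habs : (C₁.divisorMonoid.map (ModelFrobenioid.baseMap x).op).hom (ModelFrobenioid.div y) *
      ModelFrobenioid.div x = ModelFrobenioid.div x) :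
    C₂.opsData.IsPreStep (h.Ψ.functor.map y) :=
  h.functor_map_isPreStep_of_comp_eq_self x y ((ModelFrobenioid.comp_eq_self_iff_div x y hd hb hu).mpr habs)

/-- **F-2809 on divisor-absorbed translations, direction `Ψ⁻¹`.** [cite: MochizukiEtTh2009, Cor 3.8 p.81] -/
theorem inverse_map_isPreStep_of_div_absorbed {W X : C₂.category} (x : W ⟶ X) (y : X ⟶ X)
    (hd : ModelFrobenioid.degFr y = 1) (hb : ModelFrobenioid.baseMap y = 𝟙 X.base) (hu : ModelFrobenioid.unit y = 1)
    (habs : (C₂.divisorMonoid.map (ModelFrobenioid.baseMap x).op).hom (ModelFrobenioid.div y) *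
      ModelFrobenioid.div x = ModelFrobenioid.div x) :
    C₁.opsData.IsPreStep (h.Ψ.inverse.map y) :=
  h.inverse_map_isPreStep_of_comp_eq_self x y ((ModelFrobenioid.comp_eq_self_iff_div x y hd hb hu).mpr habs)

end Cor38Hyp

end Literature.AnabelianGeometry.EtaleTheta
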